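import Summits.AtomisticToContinuum.Crystallization.Theorems.ChargedEnergyGapBarlowCount
import Literature.MathematicalPhysics.StatisticalMechanics.HcpFccLatticeSumsLayers

/-!
# `OverbindingBudget` / crux `RobustDefectLimitWindows` (stmt-AtomisticToContinuum-31280) — «RunCut» D1: the far-cone packing lemma

Support file (lens-4 g86; DEMAND D1 of critic row 1526 for the competitor leaf **SW♭** `StackSwapGainFlat(Wide)`): the far-coarse
matter bound of memo `g85/memo/SW-S3.md` §5.2 (b) lands as a LEMMA WITH AN EXPLICIT PACKING CONSTANT FOR `s`-SEPARATED POINT SETS — volume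
packing (disjoint `s/2`-balls), never a lattice density.

THE LEMMA (`sum_inv_pow_far_le`, general exponent `k + 3`, `k ≥ 1`; `sum_inv_pow_eight_far_le`, the `d⁻⁸` case the second-order far coupling
needs).  For a finite `s`-separated `T ⊂ E3`, a centre `p`, and an integer radius `n₀ ≥ 1` (in units of `s`):

  `∑_{q ∈ T, n₀·s ≤ |q − p|} |q − p|^{-(k+3)} ≤ s^{-(k+3)} · B(n₀, k)`,
  `B(n₀,k) = (24/k)·n₀^{-k} + (48 + 48/(k+1))·n₀^{-(k+1)} + (48 + 26/(k+2))·n₀^{-(k+2)} + 28·n₀^{-(k+3)}`,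

whose leading constant `24/k = (6/π)·(4π/k)` is the sharp volume-packing one (density `≤ 6/(π s³)` integrated against `r^{-(k+3)}` beyond
`R = n₀ s`); for `k = 5` and `n₀ ≥ 50`: `∑ |q − p|⁻⁸ ≤ 6 · s⁻⁸ · n₀⁻⁵ = 6/(s³ R⁵)` (`sum_inv_pow_eight_far_le`; `38/5` for `n₀ ≥ 21`, `…_of_le_21`).

PROOF = CUMULATIVE SHELL COUNT + ABEL SUMMATION, both finite: (i) `card_filter_le_shellCap` — the points with `n₀ s ≤ |q−p| < n s` number at most
`G(n) = 8((n + 1/2)³ − (n₀ − 1/2)³)` (the tree's sharp ANNULUS PACKING `…ChargedEnergyGapChartDial.card_mul_le_of_separated_annulus`, cited by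
name); (ii) `inv_pow_le_telescope` — pointwise, `|q−p|^{-e} ≤ s^{-e}(∑_{n₀ ≤ n < M} 𝟙[|q−p| < (n+1)s]·(n^{-e} − (n+1)^{-e}) + M^{-e})`
(`⌊|q−p|/s⌋` and telescoping); (iii) summing over `q` and exchanging the sums turns indicators into cumulative counts `≤ G(n+1)`; (iv) the ABEL
IDENTITY `abel_identity` rewrites `∑ (aₙ − aₙ₊₁)G(n+1) + G(M)a_M = G(n₀)a_{n₀} + ∑ (G(n+1) − G(n))aₙ` with `G(n+1) − G(n) = 24n² + 48n + 26`,
`G(n₀) = 24n₀² + 2`; (v) the tails `∑_{n ≥ n₀} n^{-(d+1)} ≤ n₀^{-(d+1)} + (1/d)n₀^{-d}` are the kit's `sum_inv_pow_Ioc_le` (`…HcpFccLatticeSumsLayers`).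

USE (memo `g86/memo/SW-G1.md` §3, restating `SW-S3.md` §4/§5.2 with this constant): non-currency sound far matter is `17/50`-separated (the
`#fine` rebate of SW♭), a mover at own scale `a` sees it beyond `22a ≥ n₀·(17/50)` with `n₀ = ⌊22a·50/17⌋ ≥ 54` on the wide box, and the
α-averaged second-order far coupling is `≤ (a²/6)·|q−p|⁻⁸` per partner, so the far-coarse loss is `≤ a²·(50/17)³·(n₀·17/50)⁻⁵ ≤ a²/(s³(22a − s)⁵)`
per mover: `8.1·10⁻⁶` at `a = 17/20` (three movers: `7.3 %` of the certified TRIPLE gain `3.30·10⁻⁴`), `6.3·10⁻⁷` at `a = 2` (three movers: `40 %`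
of `4.68·10⁻⁶`; inside the `88 %` margin) — charged against `…TwinGainWide.tripleGain_profile` in the assembly (hand-in 3).
[this file: 1 definition (`shellCap`) + 10 theorems; standard axioms]
-/

noncomputable section

namespace Summit.AtomisticToContinuum.Crystallization.Theorems.OverbindingBudgetAffineRunCutFarCone

open Finset
open Literature.MathematicalPhysics.StatisticalMechanics.StackingSums (sum_inv_pow_Ioc_le)

-- (landing lane, hand-2 g40, critic row 1535: the file-local `notation "E3"` replaced by the tree abbreviation of the same name)
open Summit.AtomisticToContinuum.Crystallization.Theorems.ChargedEnergyGapNegative (E3)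

/-! ## (i) The cumulative shell cap -/

/-- **Cumulative shell cap** `G(n) = 8((n + 1/2)³ − (n₀ − 1/2)³)`: the volume-packing bound for the number of `s`-separated points with
`n₀ s ≤ |q − p| < n s`. [this file · kind: definition] -/
def shellCap (n₀ n : ℕ) : ℝ :=
  8 * (((n : ℝ) + 1 / 2) ^ 3 - ((n₀ : ℝ) - 1 / 2) ^ 3)

/-- `G(n₀) = 24 n₀² + 2`. [folklore] -/
theorem shellCap_self (n₀ : ℕ) : shellCap n₀ n₀ = 24 * (n₀ : ℝ) ^ 2 + 2 := by
  unfold shellCap; ring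

/-- `G(n+1) − G(n) = 24n² + 48n + 26`. [folklore] -/
theorem shellCap_succ_sub (n₀ n : ℕ) : shellCap n₀ (n + 1) - shellCap n₀ n = 24 * (n : ℝ) ^ 2 + 48 * n + 26 := by
  unfold shellCap; push_cast; ring

/-- ★ **CUMULATIVE ANNULUS COUNT**: the points of an `s`-separated finite `T ⊂ E3` with `n₀ s ≤ |q − p| < n s` number at most `G(n)`
(`1 ≤ n₀ ≤ n`; the tree's `card_mul_le_of_separated_annulus` with inner radius `n₀ s`). [this file · kind: proof] -/
theorem card_filter_le_shellCap (T : Finset E3) {s : ℝ} (hs : 0 < s) (p : E3)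
    (hsep : ∀ q ∈ T, ∀ q' ∈ T, q ≠ q' → s ≤ dist q q') {n₀ n : ℕ} (hn₀ : 1 ≤ n₀) (hn : n₀ ≤ n) :
    (#(T.filter fun q => (n₀ : ℝ) * s ≤ dist q p ∧ dist q p < (n : ℝ) * s) : ℝ) ≤ shellCap n₀ n := by
  set T' := T.filter fun q => (n₀ : ℝ) * s ≤ dist q p ∧ dist q p < (n : ℝ) * s with hT'
  have hn₀' : (1 : ℝ) ≤ n₀ := by exact_mod_cast hn₀
  have hR : s / 2 ≤ (n₀ : ℝ) * s := by nlinarith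
  have ht : (0 : ℝ) ≤ ((n : ℝ) - n₀) * s := mul_nonneg (sub_nonneg.2 (by exact_mod_cast hn)) hs.le
  have h := ChargedEnergyGapChartDial.card_mul_le_of_separated_annulus T' hs hR ht p
    (fun q hq q' hq' hne => hsep q (mem_of_mem_filter q hq) q' (mem_of_mem_filter q' hq') hne)
    (fun q hq => by
      have h2 := (mem_filter.1 hq).2
      exact ⟨h2.1, by linarith [h2.2]⟩)
  have e1 : ((n₀ : ℝ) * s - s / 2) ^ 3 = (s / 2) ^ 3 * (8 * ((n₀ : ℝ) - 1 / 2) ^ 3) := by ring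
  have e2 : ((n₀ : ℝ) * s + ((n : ℝ) - n₀) * s + s / 2) ^ 3 = (s / 2) ^ 3 * (8 * ((n : ℝ) + 1 / 2) ^ 3) := by ring
  rw [e1, e2] at h
  have hs3 : (0 : ℝ) < (s / 2) ^ 3 := by positivity
  have h' : (s / 2) ^ 3 * (#T' : ℝ) ≤ (s / 2) ^ 3 * shellCap n₀ n := by unfold shellCap; linarith
  exact le_of_mul_le_mul_left h' hs3

/-! ## (ii) Pointwise telescoping -/

/-- The telescoping weights `aₙ − aₙ₊₁`, `aₙ = n^{-e}`, are nonnegative (`n ≥ 1`). [folklore] -/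
theorem inv_pow_sub_nonneg (e : ℕ) {n : ℕ} (hn : 1 ≤ n) :
    (0 : ℝ) ≤ ((n : ℝ)⁻¹) ^ e - (((n + 1 : ℕ) : ℝ)⁻¹) ^ e := by
  have h1 : (0 : ℝ) < n := by exact_mod_cast hn
  have h2 : (n : ℝ) ≤ ((n + 1 : ℕ) : ℝ) := by push_cast; linarith
  exact sub_nonneg.2 (pow_le_pow_left₀ (by positivity) (inv_anti₀ h1 h2) e)

/-- Telescoping: `∑_{m ≤ n < M} (aₙ − aₙ₊₁) = a_m − a_M` (`m ≤ M`). [folklore] -/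
theorem sum_Ico_telescope (e : ℕ) {m M : ℕ} (hmM : m ≤ M) :
    ∑ n ∈ Ico m M, (((n : ℝ)⁻¹) ^ e - (((n + 1 : ℕ) : ℝ)⁻¹) ^ e) = ((m : ℝ)⁻¹) ^ e - ((M : ℝ)⁻¹) ^ e := by
  induction M, hmM using Nat.le_induction with
  | base => simp
  | succ M hM ih => rw [sum_Ico_succ_top hM, ih]; ring

/-- ★ **POINTWISE TELESCOPING**: for `n₀ s ≤ d < M s` (`n₀ ≥ 1`, `s > 0`),
`d^{-e} ≤ s^{-e}·(∑_{n₀ ≤ n < M} 𝟙[d < (n+1)s]·(n^{-e} − (n+1)^{-e}) + M^{-e})` (via `m = ⌊d/s⌋`: the indicator is `1` exactly from `m` on).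
[this file · kind: proof] -/
theorem inv_pow_le_telescope (e : ℕ) {s d : ℝ} (hs : 0 < s) {n₀ M : ℕ} (hn₀ : 1 ≤ n₀) (hlo : (n₀ : ℝ) * s ≤ d)
    (hhi : d < (M : ℝ) * s) :
    (d⁻¹) ^ e ≤ (s⁻¹) ^ e * ((∑ n ∈ Ico n₀ M, if d < ((n : ℝ) + 1) * s then ((n : ℝ)⁻¹) ^ e - (((n + 1 : ℕ) : ℝ)⁻¹) ^ e else 0)
      + ((M : ℝ)⁻¹) ^ e) := by
  have hds : 0 ≤ d / s := div_nonneg (by nlinarith [(show (1 : ℝ) ≤ n₀ by exact_mod_cast hn₀)]) hs.le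
  set m := ⌊d / s⌋₊ with hmdef
  have hm1 : (m : ℝ) ≤ d / s := Nat.floor_le hds
  have hm2 : d / s < (m : ℝ) + 1 := Nat.lt_floor_add_one _
  have hn₀m : n₀ ≤ m := Nat.le_floor (by rw [le_div_iff₀ hs]; exact hlo)
  have hmM : m < M := by rw [hmdef, Nat.floor_lt hds, div_lt_iff₀ hs]; exact hhi
  have hmpos : (0 : ℝ) < m := by exact_mod_cast (lt_of_lt_of_le (by omega : 0 < n₀) hn₀m)
  have hdm : (m : ℝ) * s ≤ d := by rwa [le_div_iff₀ hs] at hm1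
  -- the sum dominates the telescoping sum from `m`
  have hsum : ∑ n ∈ Ico m M, (((n : ℝ)⁻¹) ^ e - (((n + 1 : ℕ) : ℝ)⁻¹) ^ e) ≤
      ∑ n ∈ Ico n₀ M, (if d < ((n : ℝ) + 1) * s then ((n : ℝ)⁻¹) ^ e - (((n + 1 : ℕ) : ℝ)⁻¹) ^ e else 0) := by
    have hsub : Ico m M ⊆ Ico n₀ M := Ico_subset_Ico hn₀m le_rfl
    rw [← sum_sdiff hsub]
    have h1 : ∑ n ∈ Ico m M, (if d < ((n : ℝ) + 1) * s then ((n : ℝ)⁻¹) ^ e - (((n + 1 : ℕ) : ℝ)⁻¹) ^ e else 0) =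
        ∑ n ∈ Ico m M, (((n : ℝ)⁻¹) ^ e - (((n + 1 : ℕ) : ℝ)⁻¹) ^ e) := by
      refine sum_congr rfl fun n hn => ?_
      have hmn : (m : ℝ) ≤ n := by exact_mod_cast (mem_Ico.1 hn).1
      have : d < ((n : ℝ) + 1) * s := by
        rw [div_lt_iff₀ hs] at hm2; nlinarith
      rw [if_pos this]
    rw [h1]
    have h2 : 0 ≤ ∑ n ∈ Ico n₀ M \ Ico m M,
        (if d < ((n : ℝ) + 1) * s then ((n : ℝ)⁻¹) ^ e - (((n + 1 : ℕ) : ℝ)⁻¹) ^ e else 0) :=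
      sum_nonneg fun n hn => by
        split_ifs
        · exact inv_pow_sub_nonneg e (le_trans hn₀ (mem_Ico.1 (mem_sdiff.1 hn).1).1)
        · exact le_rfl
    linarith
  rw [sum_Ico_telescope e hmM.le] at hsum
  -- `d^{-e} ≤ (m s)^{-e} = s^{-e} m^{-e}`
  have hdpos : 0 < d := lt_of_lt_of_le (mul_pos hmpos hs) hdm
  have hkey : (d⁻¹) ^ e ≤ (s⁻¹) ^ e * ((m : ℝ)⁻¹) ^ e := by
    rw [← mul_pow, ← mul_inv, mul_comm s]
    exact pow_le_pow_left₀ (inv_nonneg.2 hdpos.le) (inv_anti₀ (mul_pos hmpos hs) hdm) e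
  have hse : (0 : ℝ) ≤ (s⁻¹) ^ e := by positivity
  nlinarith [mul_le_mul_of_nonneg_left hsum hse]

/-! ## (iv) The Abel identity and the tails -/

/-- **ABEL IDENTITY** (finite summation by parts from `n₀`):
`∑_{n₀ ≤ n < M} (aₙ − aₙ₊₁)·G(n+1) + G(M)·a_M = G(n₀)·a_{n₀} + ∑_{n₀ ≤ n < M} (G(n+1) − G(n))·aₙ`. [folklore] -/
theorem abel_identity (a G : ℕ → ℝ) {n₀ M : ℕ} (h : n₀ ≤ M) :
    ∑ n ∈ Ico n₀ M, (a n - a (n + 1)) * G (n + 1) + G M * a M =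
      G n₀ * a n₀ + ∑ n ∈ Ico n₀ M, (G (n + 1) - G n) * a n := by
  induction M, h using Nat.le_induction with
  | base => simp
  | succ M hM ih =>
    rw [sum_Ico_succ_top hM, sum_Ico_succ_top hM]
    linear_combination ih

/-- **Tail of an inverse power from `n₀`** (the kit's `sum_inv_pow_Ioc_le` plus the first term):
`∑_{n₀ ≤ n < M} n^{-(d+1)} ≤ n₀^{-(d+1)} + (1/d)·n₀^{-d}` (`n₀, d ≥ 1`). [this file · kind: proof] -/
theorem sum_Ico_inv_pow_le {d : ℕ} (hd : 1 ≤ d) {n₀ : ℕ} (hn₀ : 1 ≤ n₀) (M : ℕ) :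
    ∑ n ∈ Ico n₀ M, ((n : ℝ)⁻¹) ^ (d + 1) ≤ ((n₀ : ℝ)⁻¹) ^ (d + 1) + 1 / d * ((n₀ : ℝ)⁻¹) ^ d := by
  rcases le_or_gt M n₀ with hM | hM
  · rw [Ico_eq_empty_of_le hM, sum_empty]; positivity
  · rw [← sum_Ico_consecutive _ (Nat.le_succ n₀) (by omega : n₀ + 1 ≤ M), Nat.Ico_succ_singleton, sum_singleton,
      sum_Ico_eq_sum_range]
    have h := sum_inv_pow_Ioc_le hd hn₀ (M - (n₀ + 1))
    have e : ∀ m : ℕ, ((n₀ + 1 + m : ℕ) : ℝ) = ((m + n₀ + 1 : ℕ) : ℝ) := fun m => by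
      simp only [Nat.cast_add, Nat.cast_one]; ring
    simp_rw [e]
    linarith

/-! ## (iii)+(v) The far-cone sum -/

/-- ★★ **FAR-CONE PACKING LEMMA** (general exponent `k+3`, `k ≥ 1`): for a finite `s`-separated `T ⊂ E3`, a centre `p` and an integer
radius `n₀ ≥ 1` (units of `s`),
`∑_{q ∈ T, n₀ s ≤ |q−p|} |q−p|^{-(k+3)} ≤ s^{-(k+3)}·((24/k)n₀^{-k} + (48 + 48/(k+1))n₀^{-(k+1)} + (48 + 26/(k+2))n₀^{-(k+2)} + 28 n₀^{-(k+3)})`.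
[this file · kind: proof] -/
theorem sum_inv_pow_far_le (T : Finset E3) {s : ℝ} (hs : 0 < s) (p : E3)
    (hsep : ∀ q ∈ T, ∀ q' ∈ T, q ≠ q' → s ≤ dist q q') {n₀ : ℕ} (hn₀ : 1 ≤ n₀) {k : ℕ} (hk : 1 ≤ k) :
    ∑ q ∈ T.filter (fun q => (n₀ : ℝ) * s ≤ dist q p), ((dist q p)⁻¹) ^ (k + 3) ≤
      (s⁻¹) ^ (k + 3) * (24 / k * ((n₀ : ℝ)⁻¹) ^ k + (48 + 48 / (k + 1)) * ((n₀ : ℝ)⁻¹) ^ (k + 1)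
        + (48 + 26 / (k + 2)) * ((n₀ : ℝ)⁻¹) ^ (k + 2) + 28 * ((n₀ : ℝ)⁻¹) ^ (k + 3)) := by
  set T' := T.filter (fun q => (n₀ : ℝ) * s ≤ dist q p) with hT'
  -- a horizon `M` beyond every point, `n₀ ≤ M`
  set M : ℕ := T'.sup (fun q => ⌊dist q p / s⌋₊) + n₀ + 1 with hMdef
  have hn₀M : n₀ ≤ M := by omega
  have hlt : ∀ q ∈ T', dist q p < (M : ℝ) * s := by
    intro q hq
    have h1 : ⌊dist q p / s⌋₊ ≤ T'.sup (fun q => ⌊dist q p / s⌋₊) := le_sup (f := fun q => ⌊dist q p / s⌋₊) hq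
    have h2 : dist q p / s < (⌊dist q p / s⌋₊ : ℝ) + 1 := Nat.lt_floor_add_one _
    have h3 : ((⌊dist q p / s⌋₊ : ℕ) : ℝ) + 1 ≤ M := by
      rw [hMdef]; push_cast
      have : ((⌊dist q p / s⌋₊ : ℕ) : ℝ) ≤ ((T'.sup (fun q => ⌊dist q p / s⌋₊) : ℕ) : ℝ) := by exact_mod_cast h1
      have : (0 : ℝ) ≤ n₀ := by positivity
      linarith
    rw [div_lt_iff₀ hs] at h2
    calc dist q p < (((⌊dist q p / s⌋₊ : ℕ) : ℝ) + 1) * s := h2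
      _ ≤ (M : ℝ) * s := mul_le_mul_of_nonneg_right h3 hs.le
  -- the weights and the indicator sums
  set a : ℕ → ℝ := fun n => ((n : ℝ)⁻¹) ^ (k + 3) with ha
  have hw : ∀ n, 1 ≤ n → 0 ≤ a n - a (n + 1) := fun n hn => by
    simp only [ha]; exact_mod_cast inv_pow_sub_nonneg (k + 3) hn
  -- (ii) pointwise, summed over `T'`
  have hpt : ∑ q ∈ T', ((dist q p)⁻¹) ^ (k + 3) ≤
      ∑ q ∈ T', (s⁻¹) ^ (k + 3) *
        ((∑ n ∈ Ico n₀ M, if dist q p < ((n : ℝ) + 1) * s then a n - a (n + 1) else 0) + a M) := by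
    refine sum_le_sum fun q hq => ?_
    have h := inv_pow_le_telescope (k + 3) hs hn₀ (mem_filter.1 hq).2 (hlt q hq)
    simp only [ha]; push_cast at h ⊢; exact h
  -- (iii) exchange: indicators become cumulative counts
  have hex : ∑ q ∈ T', (s⁻¹) ^ (k + 3) *
      ((∑ n ∈ Ico n₀ M, if dist q p < ((n : ℝ) + 1) * s then a n - a (n + 1) else 0) + a M) =
      (s⁻¹) ^ (k + 3) * (∑ n ∈ Ico n₀ M, (a n - a (n + 1)) *
        (#(T.filter fun q => (n₀ : ℝ) * s ≤ dist q p ∧ dist q p < ((n + 1 : ℕ) : ℝ) * s) : ℝ) + (#T' : ℝ) * a M) := by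
    rw [← mul_sum, sum_add_distrib, sum_comm, sum_const, nsmul_eq_mul]
    congr 2
    refine sum_congr rfl fun n _ => ?_
    rw [← sum_filter, sum_const, nsmul_eq_mul, mul_comm, hT', filter_filter]
    congr 3
    ext q; push_cast; rfl
  -- the counts are capped by `G`
  have hcount : ∀ n ∈ Ico n₀ M, (a n - a (n + 1)) *
      (#(T.filter fun q => (n₀ : ℝ) * s ≤ dist q p ∧ dist q p < ((n + 1 : ℕ) : ℝ) * s) : ℝ) ≤
        (a n - a (n + 1)) * shellCap n₀ (n + 1) := fun n hn =>
    mul_le_mul_of_nonneg_left (card_filter_le_shellCap T hs p hsep hn₀ (by have := (mem_Ico.1 hn).1; omega))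
      (hw n (le_trans hn₀ (mem_Ico.1 hn).1))
  have hT'card : (#T' : ℝ) ≤ shellCap n₀ M := by
    have hTeq : T' = T.filter fun q => (n₀ : ℝ) * s ≤ dist q p ∧ dist q p < (M : ℝ) * s := by
      ext q
      simp only [hT', mem_filter]
      constructor
      · intro h; exact ⟨h.1, h.2, hlt q (by rw [hT', mem_filter]; exact h)⟩
      · intro h; exact ⟨h.1, h.2.1⟩
    rw [hTeq]; exact card_filter_le_shellCap T hs p hsep hn₀ hn₀M
  have haM : 0 ≤ a M := by simp only [ha]; positivity
  have hse : (0 : ℝ) ≤ (s⁻¹) ^ (k + 3) := by positivity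
  -- (iv) Abel
  have habel := abel_identity a (shellCap n₀) hn₀M
  have hmain : ∑ q ∈ T', ((dist q p)⁻¹) ^ (k + 3) ≤
      (s⁻¹) ^ (k + 3) * (shellCap n₀ n₀ * a n₀ + ∑ n ∈ Ico n₀ M, (shellCap n₀ (n + 1) - shellCap n₀ n) * a n) := by
    rw [← habel]
    refine (hpt.trans (le_of_eq hex)).trans (mul_le_mul_of_nonneg_left ?_ hse)
    have := sum_le_sum hcount
    nlinarith [mul_le_mul_of_nonneg_right hT'card haM]
  refine hmain.trans (mul_le_mul_of_nonneg_left ?_ hse)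
  -- (v) explicit tails
  rw [shellCap_self]
  simp_rw [shellCap_succ_sub]
  have epow : ∀ n ∈ Ico n₀ M, (24 * (n : ℝ) ^ 2 + 48 * n + 26) * a n =
      24 * ((n : ℝ)⁻¹) ^ (k + 1) + 48 * ((n : ℝ)⁻¹) ^ (k + 2) + 26 * ((n : ℝ)⁻¹) ^ (k + 3) := by
    intro n hn
    have hn0 : (n : ℝ) ≠ 0 := by exact_mod_cast (show n ≠ 0 by have := (mem_Ico.1 hn).1; omega)
    have i1 : (n : ℝ) * (n : ℝ)⁻¹ = 1 := mul_inv_cancel₀ hn0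
    simp only [ha]
    linear_combination ((n : ℝ)⁻¹) ^ (k + 1) * (24 * ((n : ℝ) * (n : ℝ)⁻¹ + 1) + 48 * (n : ℝ)⁻¹) * i1
  rw [sum_congr rfl epow, sum_add_distrib, sum_add_distrib, ← mul_sum, ← mul_sum, ← mul_sum]
  have hn0 : (n₀ : ℝ) ≠ 0 := by exact_mod_cast (show n₀ ≠ 0 by omega)
  have i1 : (n₀ : ℝ) * (n₀ : ℝ)⁻¹ = 1 := mul_inv_cancel₀ hn0
  have en : (24 * (n₀ : ℝ) ^ 2 + 2) * a n₀ = 24 * ((n₀ : ℝ)⁻¹) ^ (k + 1) + 2 * ((n₀ : ℝ)⁻¹) ^ (k + 3) := by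
    simp only [ha]
    linear_combination 24 * ((n₀ : ℝ)⁻¹) ^ (k + 1) * ((n₀ : ℝ) * (n₀ : ℝ)⁻¹ + 1) * i1
  rw [en]
  have t1 : ∑ n ∈ Ico n₀ M, ((n : ℝ)⁻¹) ^ (k + 1) ≤ ((n₀ : ℝ)⁻¹) ^ (k + 1) + 1 / (k : ℝ) * ((n₀ : ℝ)⁻¹) ^ k :=
    sum_Ico_inv_pow_le (d := k) hk hn₀ M
  have t2 : ∑ n ∈ Ico n₀ M, ((n : ℝ)⁻¹) ^ (k + 2) ≤
      ((n₀ : ℝ)⁻¹) ^ (k + 2) + 1 / ((k + 1 : ℕ) : ℝ) * ((n₀ : ℝ)⁻¹) ^ (k + 1) :=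
    sum_Ico_inv_pow_le (d := k + 1) (by omega) hn₀ M
  have t3 : ∑ n ∈ Ico n₀ M, ((n : ℝ)⁻¹) ^ (k + 3) ≤
      ((n₀ : ℝ)⁻¹) ^ (k + 3) + 1 / ((k + 2 : ℕ) : ℝ) * ((n₀ : ℝ)⁻¹) ^ (k + 2) :=
    sum_Ico_inv_pow_le (d := k + 2) (by omega) hn₀ M
  push_cast at t2 t3
  have t1' : 24 * ∑ n ∈ Ico n₀ M, ((n : ℝ)⁻¹) ^ (k + 1) ≤
      24 * ((n₀ : ℝ)⁻¹) ^ (k + 1) + 24 / k * ((n₀ : ℝ)⁻¹) ^ k := by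
    have e1 : (24 : ℝ) * (((n₀ : ℝ)⁻¹) ^ (k + 1) + 1 / (k : ℝ) * ((n₀ : ℝ)⁻¹) ^ k) =
        24 * ((n₀ : ℝ)⁻¹) ^ (k + 1) + 24 / k * ((n₀ : ℝ)⁻¹) ^ k := by ring
    rw [← e1]; exact mul_le_mul_of_nonneg_left t1 (by norm_num)
  have t2' : 48 * ∑ n ∈ Ico n₀ M, ((n : ℝ)⁻¹) ^ (k + 2) ≤
      48 * ((n₀ : ℝ)⁻¹) ^ (k + 2) + 48 / ((k : ℝ) + 1) * ((n₀ : ℝ)⁻¹) ^ (k + 1) := by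
    have e1 : (48 : ℝ) * (((n₀ : ℝ)⁻¹) ^ (k + 2) + 1 / ((k : ℝ) + 1) * ((n₀ : ℝ)⁻¹) ^ (k + 1)) =
        48 * ((n₀ : ℝ)⁻¹) ^ (k + 2) + 48 / ((k : ℝ) + 1) * ((n₀ : ℝ)⁻¹) ^ (k + 1) := by ring
    rw [← e1]; exact mul_le_mul_of_nonneg_left t2 (by norm_num)
  have t3' : 26 * ∑ n ∈ Ico n₀ M, ((n : ℝ)⁻¹) ^ (k + 3) ≤
      26 * ((n₀ : ℝ)⁻¹) ^ (k + 3) + 26 / ((k : ℝ) + 2) * ((n₀ : ℝ)⁻¹) ^ (k + 2) := by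
    have e1 : (26 : ℝ) * (((n₀ : ℝ)⁻¹) ^ (k + 3) + 1 / ((k : ℝ) + 2) * ((n₀ : ℝ)⁻¹) ^ (k + 2)) =
        26 * ((n₀ : ℝ)⁻¹) ^ (k + 3) + 26 / ((k : ℝ) + 2) * ((n₀ : ℝ)⁻¹) ^ (k + 2) := by ring
    rw [← e1]; exact mul_le_mul_of_nonneg_left t3 (by norm_num)
  have eA : (48 + 48 / ((k : ℝ) + 1)) * ((n₀ : ℝ)⁻¹) ^ (k + 1) =
      48 * ((n₀ : ℝ)⁻¹) ^ (k + 1) + 48 / ((k : ℝ) + 1) * ((n₀ : ℝ)⁻¹) ^ (k + 1) := by ring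
  have eB : (48 + 26 / ((k : ℝ) + 2)) * ((n₀ : ℝ)⁻¹) ^ (k + 2) =
      48 * ((n₀ : ℝ)⁻¹) ^ (k + 2) + 26 / ((k : ℝ) + 2) * ((n₀ : ℝ)⁻¹) ^ (k + 2) := by ring
  linarith [t1', t2', t3', eA, eB]

/-- ★★ **THE `d⁻⁸` FAR CONE** (second-order far coupling; `n₀ ≥ 50`): `∑_{q ∈ T, n₀ s ≤ |q−p|} |q−p|⁻⁸ ≤ 6 · s⁻⁸ · n₀⁻⁵` — i.e. `≤ 6/(s³ R⁵)`
with `R = n₀ s`; the sharp volume-packing constant is `24/5`, the `25 %` covers the discretisation at `n₀ ≥ 50`. [this file · kind: proof] -/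
theorem sum_inv_pow_eight_far_le (T : Finset E3) {s : ℝ} (hs : 0 < s) (p : E3)
    (hsep : ∀ q ∈ T, ∀ q' ∈ T, q ≠ q' → s ≤ dist q q') {n₀ : ℕ} (hn₀ : 50 ≤ n₀) :
    ∑ q ∈ T.filter (fun q => (n₀ : ℝ) * s ≤ dist q p), ((dist q p)⁻¹) ^ 8 ≤ 6 * (s⁻¹) ^ 8 * ((n₀ : ℝ)⁻¹) ^ 5 := by
  have h := sum_inv_pow_far_le T hs p hsep (n₀ := n₀) (by omega) (k := 5) (by norm_num)
  have hn : (50 : ℝ) ≤ n₀ := by exact_mod_cast hn₀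
  have hu0 : (0 : ℝ) < (n₀ : ℝ)⁻¹ := by positivity
  have hu : ((n₀ : ℝ)⁻¹) ≤ 1 / 50 := by rw [one_div]; exact inv_anti₀ (by norm_num) hn
  set u : ℝ := (n₀ : ℝ)⁻¹ with hudef
  have h6 : u ^ 6 ≤ u ^ 5 * (1 / 50) := by
    rw [pow_succ]; exact mul_le_mul_of_nonneg_left hu (pow_nonneg hu0.le 5)
  have h7 : u ^ 7 ≤ u ^ 6 * (1 / 50) := by
    rw [pow_succ]; exact mul_le_mul_of_nonneg_left hu (pow_nonneg hu0.le 6)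
  have h8 : u ^ 8 ≤ u ^ 7 * (1 / 50) := by
    rw [pow_succ]; exact mul_le_mul_of_nonneg_left hu (pow_nonneg hu0.le 7)
  have h5 : (0 : ℝ) ≤ u ^ 5 := pow_nonneg hu0.le 5
  -- `24/5·u⁵ + 56·u⁶ + (362/7)·u⁷ + 28·u⁸ ≤ 6·u⁵` for `0 ≤ u ≤ 1/50`
  have key : 24 / ((5 : ℕ) : ℝ) * u ^ 5 + (48 + 48 / (((5 : ℕ) : ℝ) + 1)) * u ^ (5 + 1)
      + (48 + 26 / (((5 : ℕ) : ℝ) + 2)) * u ^ (5 + 2) + 28 * u ^ (5 + 3) ≤ 6 * u ^ 5 := by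
    norm_num
    linarith
  calc _ ≤ _ := h
    _ ≤ (s⁻¹) ^ (5 + 3) * (6 * u ^ 5) := mul_le_mul_of_nonneg_left key (by positivity)
    _ = 6 * (s⁻¹) ^ 8 * u ^ 5 := by ring

/-- ★ **Lattice-scale version** (`n₀ ≥ 21`, e.g. the fcc sites of spacing `s = a` beyond the near ball `22a − |b|`): `∑ |q − p|⁻⁸ ≤ (38/5)·s⁻⁸·n₀⁻⁵`
(`24/5 + 56/21 + 362/(7·21²) + 28/21³ = 7.587…`).  Used for the α-averaged second-order LATTICE remainder beyond the exactly-summed ball (memo §4).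
[this file · kind: proof] -/
theorem sum_inv_pow_eight_far_le_of_le_21 (T : Finset E3) {s : ℝ} (hs : 0 < s) (p : E3)
    (hsep : ∀ q ∈ T, ∀ q' ∈ T, q ≠ q' → s ≤ dist q q') {n₀ : ℕ} (hn₀ : 21 ≤ n₀) :
    ∑ q ∈ T.filter (fun q => (n₀ : ℝ) * s ≤ dist q p), ((dist q p)⁻¹) ^ 8 ≤ 38 / 5 * (s⁻¹) ^ 8 * ((n₀ : ℝ)⁻¹) ^ 5 := by
  have h := sum_inv_pow_far_le T hs p hsep (n₀ := n₀) (by omega) (k := 5) (by norm_num)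
  have hn : (21 : ℝ) ≤ n₀ := by exact_mod_cast hn₀
  have hu0 : (0 : ℝ) < (n₀ : ℝ)⁻¹ := by positivity
  have hu : ((n₀ : ℝ)⁻¹) ≤ 1 / 21 := by rw [one_div]; exact inv_anti₀ (by norm_num) hn
  set u : ℝ := (n₀ : ℝ)⁻¹ with hudef
  have h6 : u ^ 6 ≤ u ^ 5 * (1 / 21) := by
    rw [pow_succ]; exact mul_le_mul_of_nonneg_left hu (pow_nonneg hu0.le 5)
  have h7 : u ^ 7 ≤ u ^ 6 * (1 / 21) := by
    rw [pow_succ]; exact mul_le_mul_of_nonneg_left hu (pow_nonneg hu0.le 6)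
  have h8 : u ^ 8 ≤ u ^ 7 * (1 / 21) := by
    rw [pow_succ]; exact mul_le_mul_of_nonneg_left hu (pow_nonneg hu0.le 7)
  have h5 : (0 : ℝ) ≤ u ^ 5 := pow_nonneg hu0.le 5
  have key : 24 / ((5 : ℕ) : ℝ) * u ^ 5 + (48 + 48 / (((5 : ℕ) : ℝ) + 1)) * u ^ (5 + 1)
      + (48 + 26 / (((5 : ℕ) : ℝ) + 2)) * u ^ (5 + 2) + 28 * u ^ (5 + 3) ≤ 38 / 5 * u ^ 5 := by
    norm_num
    linarith
  calc _ ≤ _ := h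
    _ ≤ (s⁻¹) ^ (5 + 3) * (38 / 5 * u ^ 5) := mul_le_mul_of_nonneg_left key (by positivity)
    _ = 38 / 5 * (s⁻¹) ^ 8 * u ^ 5 := by ring

end Summit.AtomisticToContinuum.Crystallization.Theorems.OverbindingBudgetAffineRunCutFarCone

end
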